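/- Copyright: the b2b-balaban cell (near-miss cell 7), T⁴-continuum fan-out, lineage t4-ne7b-p1 (node U5c COUNT
member).  Released under the licence of the surrounding project. -/
import Summits.QuantumFields.BalabanUV.T4Continuum.Support.HistoryRealise

/-!
# Realised histories, PRINT-EXACT PENDENCY (repair core R-40-a of the located model finding F-ne7bp1g40-1): the join
and cutoff clauses with pendency STRICTLY BEFORE the scale in question, and row S1b's theorems re-derived for them
(owner module of row NE7b, lineage `t4-ne7b-p1` gen 40, ruling R-OWNER-40-2; sibling of row S1b's `HistoryRealise`
(leaf-08, p209120), which it imports and does not modify)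

Summits-side support leaf of the T⁴-continuum cell (rung (B)+1 on a FINITE torus only; NOT infinite volume, NOT the
mass gap, NOT the Clay statement; NOT a proof of the spine estimate NE7b, which is the cell's OWN estimate, NOT PRINTED
and NOT PROVED).  [folklore] finite combinatorics in the ℤᵈ index model over `HistoryRealise` (`orbit`, `Stops`,
`PendingAt`, `Realises`, `exists_stop_lt_reach`) and `HistoryWindows`; nothing printed is asserted, no `def … : Prop`
fact of Bałaban's, no cite-tagged hypothesis, zero `sorry`.  B15 = [Balaban1989LargeFieldI] p. 177 and B16 =
[Balaban1989LargeFieldII] pp. 384–387 are manuscripts UNDER AUDIT; the sentences quoted LOCATE the construction steps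
the clauses transcribe (certified reading C-B16-6; renders re-read by the owner 2026-08-21, journal F-ne7bp1g40-1).

WHY (the located finding, MODEL side — nothing here says print is wrong).  Row S1b's `Realises (join X Y sj) Z` asks
both partners to be `PendingAt … sj`: no stop at ANY index `k ≤ sj − lastStep`, i.e. the partner's image must not
satisfy the size conditions (i)∕(ii) even AT the join scale `sj`; and the reading's cutoff clause
(`HistoryRealiseCells.RealisedDomains.real`) asks `PendingAt … K` at the final level.  Print's construction: a component
of `Z_j` satisfying (i), (ii) at scale `j` is integrated by the 𝐑-operation acting on the `j`-th density, i.e. at the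
start of step `j + 1` («We consider components … such that each satisfies the following two properties: (i) … (ii) …»,
B15 p. 177; «K is the smallest positive integer having the property that the domain S^K(Z) … satisfies the conditions
(i), (ii)», B16 p. 384), unless «a new large field was introduced in the preparatory operations» (renewal, p. 385
bottom – p. 386 l. 3); and the second case of p. 386 joins «some number of components of Z_j, and some number of new
large field regions» with NO readiness clause at the join scale (p. 387: «The domains X, Y determine the corresponding
indices K₁, K₂», any values).  Hence what print guarantees for an un-renewed partner alive into the merge at `sj`, and
for a component live at the cutoff `K`, is pendency STRICTLY BEFORE that scale (`k < sj − lastStep`, resp. `k < K −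
lastStep`): a partner whose image FIRST satisfies (i)∕(ii) exactly at the join scale is print-admissible (its one
further steps are what (1.88)'s allowance `K ≤ K₂ + n₁ + R_{j+1}`, `+ O(1)3(100M)^dR^{d+2}_{j+1}` pays for) and is
NOT `Realises`-realisable.  The renewal
clause of `Realises` (ready at `h`, event at `h + 1`) is print-exact and unchanged.  THIS FILE shows the repair is free
at the geometric core: with the strict clauses every theorem of row S1b §3–§5 survives with the same conclusions.

WHAT IS DEFINED AND PROVED.  §1 `PendingBefore L s R t₀ Z K` (`t₀ ≤ K`, no stop at any `k < K − t₀`),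
`pendingBefore_of_pendingAt`, `PendingBefore.mono`.  §2 **`RealisesP L s R : PGen (Pt d × Finset (Pt d)) → Finset (Pt d) →
Prop`** — `Realises` with the join partners `PendingBefore … sj` (birth and renewal clauses verbatim);
**`realisesP_of_realises`** (the landed predicate implies the print-exact one).  §3 **`exists_stop_lt_reach_P`** (every
`RealisesP`-realised history stops strictly inside its booked life — row S1b's main theorem re-proved: in the join case
the partners' stops now lie AT OR AFTER the join scale; a partner stopping AT the join scale is print's `K₁ = 0` endpoint
of p. 387, handled by b02's `near_of_condI_touch` + `stopAt_union` within the same allowance `K₂ + 13 + R`).  §4 the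
displays re-derived: **`lt_reach_of_pendingBefore`** (pending strictly before the cutoff `K` ⟹ `K < reach` — the SAME
conclusion as `lt_reach_of_pendingAt`), `renew_lt_reach_P`, `joinInLife_of_realisesP`, `adm_of_realisesP`,
`rootAnchor_mem_rootRegion_P`, `rootAnchor_ne_of_disjoint_P`.  §5 sanity: the unit region of row S1b is
`RealisesP`-realised; a numeric instance of `exists_stop_lt_reach_P`.

HONEST.  MODEL repair core only: the carriers `RealisedDomains*` and the ENDs still quote `Realises`∕`PendingAt`
(their print-exact twins are the downstream half of R-40-a, not here); NE7b NOT proved; spine 0∕9.  HONEST DEPENDENCY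
(cell): continuum YM on T⁴ ⇐ BetaPertH ∧ nine spine estimates (0/9 proved); BetaPertH ⇐ (D1) ∧ (D4) ∧ CAP+tail;
G-an2-4 gates asym, D1 and NE2/3/4.  This file changes none of it. -/

open Finset
open Literature.MathematicalPhysics.QuantumFieldTheory.Balaban1983to89
open Literature.MathematicalPhysics.QuantumFieldTheory.Balaban1983to89.B13ScaleTransfer
open Literature.MathematicalPhysics.QuantumFieldTheory.Balaban1983to89.TreeLength
open Literature.MathematicalPhysics.QuantumFieldTheory.Balaban1983to89.B16SProfile
open Literature.MathematicalPhysics.QuantumFieldTheory.Balaban1983to89.B16StoppingRule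
open Literature.MathematicalPhysics.QuantumFieldTheory.Balaban1983to89.B16MergeGeometry
open Literature.MathematicalPhysics.QuantumFieldTheory.Balaban1983to89.B16MergeHorizon
open T4PersistenceDictionary
open Summit.QuantumFields.BalabanUV.T4Continuum.HistoryAdmissible
open Summit.QuantumFields.BalabanUV.T4Continuum.HistoryWindows
open Summit.QuantumFields.BalabanUV.T4Continuum.HistoryRealise

namespace Summit.QuantumFields.BalabanUV.T4Continuum.HistoryRealisePrint

noncomputable section

variable {d : ℕ}

/-! ## §1 Pendency strictly before a scale -/

/-- **`PendingBefore L s R t₀ Z K`**: the domain formed at `t₀ ≤ K` has not stopped at any index STRICTLY BELOW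
`K − t₀` — its images at the scales `t₀ + 1, …, K − 1` do not satisfy the size conditions (i)∕(ii); nothing is asked
at the scale `K` itself (print: a component alive at level `K − 1` and not renewed is merged at `K` or carried to the
cutoff `K` whatever its image at `K` looks like). [folklore] -/
def PendingBefore (L : ℕ) (s : ℕ → ℕ) (R : ℕ → ℕ) (t₀ : ℕ) (Z : Finset (Pt d)) (K : ℕ) : Prop :=
  t₀ ≤ K ∧ ∀ k, k < K - t₀ → ¬ Stops L s R t₀ Z k

/-- pendency through a scale implies pendency strictly before it [folklore] -/
theorem pendingBefore_of_pendingAt {L : ℕ} {s R : ℕ → ℕ} {t₀ : ℕ} {Z : Finset (Pt d)} {K : ℕ}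
    (h : PendingAt L s R t₀ Z K) : PendingBefore L s R t₀ Z K :=
  ⟨h.1, fun k hk => h.2 k hk.le⟩

/-- pendency strictly before a scale is monotone in the scale (downwards) [folklore] -/
theorem PendingBefore.mono {L : ℕ} {s R : ℕ → ℕ} {t₀ : ℕ} {Z : Finset (Pt d)} {K K' : ℕ}
    (h : PendingBefore L s R t₀ Z K) (hK : t₀ ≤ K') (hKK : K' ≤ K) : PendingBefore L s R t₀ Z K' :=
  ⟨hK, fun k hk => h.2 k (by omega)⟩

/-- a line is pending strictly before its own last step, and before the next scale [folklore] -/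
theorem pendingBefore_succ_self (L : ℕ) (s R : ℕ → ℕ) (t : ℕ) (Z : Finset (Pt d)) : PendingBefore L s R t Z (t + 1) :=
  ⟨Nat.le_succ t, fun k hk hS => by have := hS.pos; omega⟩

/-! ## §2 Realised histories with print-exact join pendency -/

/-- **REALISED HISTORIES, PRINT-EXACT** (`Realises` of row S1b with the join partners pending STRICTLY BEFORE the join
scale): a NEW REGION (anchor ∈ region, face-connected, class `≥ treeLen`); a RENEWAL at `h + 1` of a line ready AT `h`
for the first time (verbatim); a JOIN at `s` of two lines with `lastStep ≤ s`, neither having stopped at any scale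
strictly before `s`, whose current images touch, the joined domain inside their union ((1.84)). [folklore] -/
def RealisesP (L : ℕ) (s : ℕ → ℕ) (R : ℕ → ℕ) : PGen (Pt d × Finset (Pt d)) → Finset (Pt d) → Prop
  | .birth _ cls zZ, Z => zZ.2 = Z ∧ zZ.1 ∈ Z ∧ FaceConnected Z ∧ treeLen Z ≤ cls
  | .renew G h, Z => ∃ ZG, RealisesP L s R G ZG ∧ Stops L s R G.lastStep ZG (h - G.lastStep) ∧
      (∀ k, k < h - G.lastStep → ¬ Stops L s R G.lastStep ZG k) ∧ Z = orbit L s G.lastStep ZG (h + 1 - G.lastStep)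
  | .join X Y sj, Z => ∃ ZX ZY, RealisesP L s R X ZX ∧ RealisesP L s R Y ZY ∧ X.lastStep ≤ sj ∧ Y.lastStep ≤ sj ∧
      PendingBefore L s R X.lastStep ZX sj ∧ PendingBefore L s R Y.lastStep ZY sj ∧
      (∃ a ∈ orbit L s X.lastStep ZX (sj - X.lastStep), ∃ c ∈ orbit L s Y.lastStep ZY (sj - Y.lastStep), Touch a c) ∧
      Z ⊆ orbit L s X.lastStep ZX (sj - X.lastStep) ∪ orbit L s Y.lastStep ZY (sj - Y.lastStep)

/-- **THE LANDED PREDICATE IMPLIES THE PRINT-EXACT ONE** (row S1b's `Realises` asks more of the join partners).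
[folklore] -/
theorem realisesP_of_realises {L : ℕ} {s R : ℕ → ℕ} :
    ∀ (P : PGen (Pt d × Finset (Pt d))) (Z : Finset (Pt d)), Realises L s R P Z → RealisesP L s R P Z
  | .birth _ _ _, _, h => h
  | .renew G h, Z, hP => by
      obtain ⟨ZG, hG, hready, hfirst, hZ⟩ := hP
      exact ⟨ZG, realisesP_of_realises G ZG hG, hready, hfirst, hZ⟩
  | .join X Y sj, Z, hP => by
      obtain ⟨ZX, ZY, hX, hY, htX, htY, hpX, hpY, hac, hZ⟩ := hP
      exact ⟨ZX, ZY, realisesP_of_realises X ZX hX, realisesP_of_realises Y ZY hY, htX, htY,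
        pendingBefore_of_pendingAt hpX, pendingBefore_of_pendingAt hpY, hac, hZ⟩

/-! ## §3 Every print-exactly realised history stops, strictly inside its booked life -/

section Main

variable {L : ℕ} {s R : ℕ → ℕ} (hL : 4 ≤ L) (hdrop : ∀ m, DropCtl s m) (hR : ∀ t, 1 ≤ R t) {n₁ : ℕ} (hn₁ : 13 ≤ n₁)
include hL hdrop hR hn₁

/-- **MAIN THEOREM, PRINT-EXACT FORM.**  Every `RealisesP`-realised history STOPS at some `k ≥ 1` with
`lastStep + k < toGen.reach (dictW R n₁)` (`L ≥ 4`, drop control, sizes `R ≥ 1`, allowance `n₁ ≥ 13`).  Row S1b's proof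
verbatim except in the join case, where the partners' stops now lie AT OR AFTER the join scale (`sj − t ≤ k`): strictly
after for both ⟹ `HistoryWindows.stopAt_join` as before; AT the join scale for one partner (print's p. 387 argument with
`K₁ = 0`: the small partner lies within `100` of a cube of the other, `B16MergeHorizon.near_of_condI_touch`) ⟹
`B16MergeHorizon.stopAt_union` stops the union within `max (K₂ + 6) 14 + R sj − 1 ≤ K₂ + 13 + R sj`. [folklore] -/
theorem exists_stop_lt_reach_P :
    ∀ (P : PGen (Pt d × Finset (Pt d))) (Z : Finset (Pt d)), RealisesP L s R P Z →
      ∃ k, 1 ≤ k ∧ Stops L s R P.lastStep Z k ∧ P.lastStep + k < P.toGen.reach (dictW R n₁)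
  | .birth j cls zZ, Z, hRZ => exists_stop_lt_reach hL hdrop hR hn₁ (.birth j cls zZ) Z hRZ
  | .renew G h, Z, hRZ => by
      obtain ⟨ZG, -, hready, -, rfl⟩ := hRZ
      -- the renewal clause is verbatim: reuse row S1b's theorem on a `Realises`-shaped renewal of a BIRTH-free stub is
      -- not possible (the line `G` is only `RealisesP`-realised), so the short argument is repeated
      have ht : G.lastStep < h := by have := hready.pos; omega
      set t := G.lastStep with ht_def
      have hrs := stopAt_restart (show 3 ≤ L by omega) (dropCtl_from hdrop t (h - t + 1 + R (h + 1)))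
        (X := orbit L s t ZG) (fun l => orbit_succ L s t ZG l) hready.condI (hR (h + 1)) (fun _ => True)
        (fun _ _ _ => trivial) le_rfl
      refine ⟨R (h + 1), hR (h + 1), ?_, ?_⟩
      · show StopAt 100 (R (h + 1)) (fun _ => True) (orbit L s (h + 1) (orbit L s t ZG (h + 1 - t))) (R (h + 1))
        obtain ⟨-, hI, -, hall⟩ := hrs
        have hsh : ∀ l, orbit L s (h + 1) (orbit L s t ZG (h + 1 - t)) l = orbit L s t ZG (h - t + 1 + l) := by
          intro l
          rw [show h - t + 1 + l = (h + 1 - t) + l by omega, orbit_add, show t + (h + 1 - t) = h + 1 by omega]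
        refine ⟨hR (h + 1), ?_, le_rfl, fun l h1 h2 => ⟨trivial, ?_⟩⟩
        · rw [hsh]; exact hI
        · rw [hsh]; exact (hall (h - t + 1 + l) (by omega) (by omega)).2
      · have h1 := restart_lt_dictW R n₁ (h + 1)
        simp only [PGen.lastStep, PGen.toGen, Gen.reach_renew]
        omega
  | .join X Y sj, Z, hRZ => by
      obtain ⟨ZX, ZY, hX, hY, htX, htY, hpX, hpY, ⟨a, ha, c, hc, hac⟩, hZ⟩ := hRZ
      obtain ⟨kX, hkX1, hsX, hrX⟩ := exists_stop_lt_reach_P X ZX hX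
      obtain ⟨kY, hkY1, hsY, hrY⟩ := exists_stop_lt_reach_P Y ZY hY
      set tX := X.lastStep
      set tY := Y.lastStep
      -- partners pending STRICTLY BEFORE the join: their stops lie AT or after `sj`
      have hKX : sj - tX ≤ kX := by
        by_contra hlt; exact hpX.2 kX (by omega) hsX
      have hKY : sj - tY ≤ kY := by
        by_contra hlt; exact hpY.2 kY (by omega) hsY
      -- condition (i) of the partners at own indices `K₁ = tX + kX − sj`, `K₂ = tY + kY − sj` from the join scale
      have hXI : CondI 100 (Siter (ratio L fun i => s (sj + i)) (tX + kX - sj) (orbit L s tX ZX (sj - tX))) := by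
        have h := hsX.condI
        rw [show kX = (sj - tX) + (tX + kX - sj) by omega, orbit_add, show tX + (sj - tX) = sj by omega] at h
        exact h
      have hYI : CondI 100 (Siter (ratio L fun i => s (sj + i)) (tY + kY - sj) (orbit L s tY ZY (sj - tY))) := by
        have h := hsY.condI
        rw [show kY = (sj - tY) + (tY + kY - sj) by omega, orbit_add, show tY + (sj - tY) = sj by omega] at h
        exact h
      have hreach : ∀ {k K₁ K₂ : ℕ}, k ≤ max K₁ K₂ + 13 + R sj → sj + K₁ < X.toGen.reach (dictW R n₁) →
          sj + K₂ < Y.toGen.reach (dictW R n₁) →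
          (PGen.join X Y sj).lastStep + k < (PGen.join X Y sj).toGen.reach (dictW R n₁) := by
        intro k K₁ K₂ hk h₁ h₂
        have h := join_lt_dictW R hn₁ sj hk h₁ h₂
        simp only [PGen.lastStep, PGen.toGen, Gen.reach_merge]
        exact h
      by_cases h1 : tX + kX - sj = 0
      · -- THE BOUNDARY CASE OF THE FINDING: `X`'s image satisfies (i) AT the join scale (print's K₁ = 0 partner, p. 387
        -- «it is contained in a cube of the size 100MR … and it intersects S^{K₁}(Y)»): every cube of it is within
        -- `100` of `c ∈ Y`'s image, and `stopAt_union` stops the union within `max (K₂ + 6) 14 + R sj − 1`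
        have hXI0 : CondI 100 (orbit L s tX ZX (sj - tX)) := by rw [h1] at hXI; simpa using hXI
        have hnear := near_of_condI_touch hXI0 ha hac
        have hst := stopAt_union (show 2 ≤ L by omega)
          (dropCtl_from hdrop sj (max (tY + kY - sj + 6) 14 + R sj - 1)) hc (D := 100) (by norm_num) (by norm_num)
          hnear hYI (hR sj) (fun _ => True) (fun _ _ _ => trivial) le_rfl
        refine ⟨max (tY + kY - sj + 6) 14 + R sj - 1, by omega, ?_, hreach (K₁ := 0) (K₂ := tY + kY - sj)
          (by omega) (by omega) (by omega)⟩
        apply Stops.subset hZ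
        show StopAt 100 (R sj) (fun _ => True)
          (orbit L s sj (orbit L s tX ZX (sj - tX) ∪ orbit L s tY ZY (sj - tY))) _
        exact hst
      · by_cases h2 : tY + kY - sj = 0
        · -- the symmetric boundary case: `Y`'s image satisfies (i) at the join scale
          have hYI0 : CondI 100 (orbit L s tY ZY (sj - tY)) := by rw [h2] at hYI; simpa using hYI
          have hnear := near_of_condI_touch hYI0 hc hac.symm
          have hst := stopAt_union (show 2 ≤ L by omega)
            (dropCtl_from hdrop sj (max (tX + kX - sj + 6) 14 + R sj - 1)) ha (D := 100) (by norm_num) (by norm_num)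
            hnear hXI (hR sj) (fun _ => True) (fun _ _ _ => trivial) le_rfl
          refine ⟨max (tX + kX - sj + 6) 14 + R sj - 1, by omega, ?_, hreach (K₁ := tX + kX - sj) (K₂ := 0)
            (by omega) (by omega) (by omega)⟩
          apply Stops.subset hZ
          show StopAt 100 (R sj) (fun _ => True)
            (orbit L s sj (orbit L s tX ZX (sj - tX) ∪ orbit L s tY ZY (sj - tY))) _
          rw [Finset.union_comm]
          exact hst
        · -- both partners stop strictly after the join scale: row S1b's path through `stopAt_join`
          obtain ⟨k, hk1, hkle, hstop⟩ := stopAt_join (show 2 ≤ L by omega)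
            (dropCtl_from hdrop sj (max (tX + kX - sj) (tY + kY - sj) + 13 + R sj)) ha hc hac (by omega) (by omega)
            hXI hYI (hR sj) (fun _ => True) (fun _ _ _ => trivial) le_rfl
          refine ⟨k, hk1, ?_, hreach hkle (by omega) (by omega)⟩
          apply Stops.subset hZ
          show StopAt 100 (R sj) (fun _ => True)
            (orbit L s sj (orbit L s tX ZX (sj - tX) ∪ orbit L s tY ZY (sj - tY))) k
          exact hstop

/-! ## §4 The displays of row S1b, re-derived for the print-exact clauses -/

/-- **PENDING STRICTLY BEFORE THE CUTOFF ⇒ INSIDE THE BOOKED LIFE**: `K < toGen.reach (dictW R n₁)` — the SAME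
conclusion as row S1b's `lt_reach_of_pendingAt` from the weaker, print-exact cutoff clause. [folklore] -/
theorem lt_reach_of_pendingBefore {P : PGen (Pt d × Finset (Pt d))} {Z : Finset (Pt d)} (hP : RealisesP L s R P Z)
    {K : ℕ} (hK : PendingBefore L s R P.lastStep Z K) : K < P.toGen.reach (dictW R n₁) := by
  obtain ⟨k, -, hs, hlt⟩ := exists_stop_lt_reach_P hL hdrop hR hn₁ P Z hP
  have : K - P.lastStep ≤ k := by
    by_contra hlt'; exact hK.2 k (by omega) hs
  have := hK.1
  omega

/-- a renewal happens strictly inside the booked life of the renewed line [folklore] -/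
theorem renew_lt_reach_P {G : PGen (Pt d × Finset (Pt d))} {h : ℕ} {Z : Finset (Pt d)}
    (hP : RealisesP L s R (.renew G h) Z) : h < G.toGen.reach (dictW R n₁) := by
  obtain ⟨ZG, hG, hready, hfirst, -⟩ := hP
  obtain ⟨k, -, hs, hlt⟩ := exists_stop_lt_reach_P hL hdrop hR hn₁ G ZG hG
  have : h - G.lastStep ≤ k := by
    by_contra hlt'; exact hfirst k (by omega) hs
  have := hready.pos
  omega

/-- **`JoinInLife` DERIVED** for print-exactly realised histories. [folklore] -/
theorem joinInLife_of_realisesP :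
    ∀ (P : PGen (Pt d × Finset (Pt d))) (Z : Finset (Pt d)), RealisesP L s R P Z → P.JoinInLife (dictW R n₁)
  | .birth _ _ _, _, _ => trivial
  | .renew G h, Z, hP => by
      obtain ⟨ZG, hG, -, -, -⟩ := hP
      exact joinInLife_of_realisesP G ZG hG
  | .join X Y sj, Z, hP => by
      obtain ⟨ZX, ZY, hX, hY, -, -, hpX, hpY, -, -⟩ := hP
      exact ⟨joinInLife_of_realisesP X ZX hX, joinInLife_of_realisesP Y ZY hY,
        lt_reach_of_pendingBefore hL hdrop hR hn₁ hX hpX, lt_reach_of_pendingBefore hL hdrop hR hn₁ hY hpY⟩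

end Main

/-- **`Adm` DERIVED** for print-exactly realised histories. [folklore] -/
theorem adm_of_realisesP {L : ℕ} {s R : ℕ → ℕ} :
    ∀ (P : PGen (Pt d × Finset (Pt d))) (Z : Finset (Pt d)), RealisesP L s R P Z → ∀ {K : ℕ}, P.lastStep ≤ K → P.Adm K
  | .birth _ _ _, _, _, _, hK => hK
  | .renew G h, Z, hP, K, hK => by
      obtain ⟨ZG, hG, hready, -, -⟩ := hP
      have := hready.pos
      simp only [PGen.lastStep] at hK
      exact ⟨adm_of_realisesP G ZG hG (by omega), by omega, hK⟩
  | .join X Y sj, Z, hP, K, hK => by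
      obtain ⟨ZX, ZY, hX, hY, htX, htY, -, -, -, -⟩ := hP
      exact ⟨adm_of_realisesP X ZX hX (htX.trans hK), adm_of_realisesP Y ZY hY (htY.trans hK), htX, htY, hK⟩

/-! ## §5 Root anchors -/

/-- in a print-exactly realised history the root anchor lies in the root region [folklore] -/
theorem rootAnchor_mem_rootRegion_P {L : ℕ} {s R : ℕ → ℕ} :
    ∀ (P : PGen (Pt d × Finset (Pt d))) (Z : Finset (Pt d)), RealisesP L s R P Z → rootAnchor P ∈ rootRegion P
  | .birth _ _ zZ, Z, hP => by
      obtain ⟨hZ, hz, -, -⟩ := hP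
      simpa [rootAnchor, rootRegion, PGen.rootCell, hZ] using hz
  | .renew G h, Z, hP => by
      obtain ⟨ZG, hG, -, -, -⟩ := hP
      exact rootAnchor_mem_rootRegion_P G ZG hG
  | .join X Y sj, Z, hP => by
      obtain ⟨ZX, ZY, hX, hY, -, -, -, -, -, -⟩ := hP
      unfold rootAnchor rootRegion
      simp only [PGen.rootCell]
      split_ifs
      · exact rootAnchor_mem_rootRegion_P X ZX hX
      · exact rootAnchor_mem_rootRegion_P Y ZY hY

/-- root-cell distinctness of disjoint root regions, print-exact form [folklore] -/
theorem rootAnchor_ne_of_disjoint_P {L : ℕ} {s R : ℕ → ℕ} {P P' : PGen (Pt d × Finset (Pt d))} {Z Z' : Finset (Pt d)}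
    (hP : RealisesP L s R P Z) (hP' : RealisesP L s R P' Z') (hdis : Disjoint (rootRegion P) (rootRegion P')) :
    rootAnchor P ≠ rootAnchor P' := fun h =>
  Finset.disjoint_left.1 hdis (rootAnchor_mem_rootRegion_P P Z hP) (h ▸ rootAnchor_mem_rootRegion_P P' Z' hP')

/-! ## §6 Sanity -/

namespace Sanity

open B16MergeGeometry.OneDim

/-- row S1b's unit region is print-exactly realised (births are verbatim) [folklore] -/
theorem realisesP_unit (L : ℕ) (s R : ℕ → ℕ) : RealisesP L s R HistoryRealise.Sanity.unit {pt 0} :=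
  realisesP_of_realises _ _ (HistoryRealise.Sanity.realises_unit L s R)

/-- hence (constant flow, sizes `2`, allowance `13`) it stops strictly inside its booked life `4` [folklore] -/
example : ∃ k, 1 ≤ k ∧ Stops 4 (fun _ => 0) (fun _ => 2) 0 ({pt 0} : Finset (Pt 1)) k ∧ 0 + k < 4 := by
  have h := exists_stop_lt_reach_P (d := 1) (L := 4) (s := fun _ => 0) (R := fun _ => 2) le_rfl
    (fun m => B16Absorption.dropCtl_const 0 m) (fun _ => by norm_num) (n₁ := 13) le_rfl HistoryRealise.Sanity.unit
    {pt 0} (realisesP_unit 4 _ _)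
  simpa [HistoryRealise.Sanity.unit, PGen.lastStep, PGen.toGen, dictW, fatWait] using h

/-- a strictly-before pendency that FAILS the through-the-scale form: a line that stops exactly at the relative index
`K − t₀` is `PendingBefore … K` whenever it did not stop earlier — the boundary case the finding is about, in the
abstract (`Stops` is left as a hypothesis; no geometry is decided here). [folklore] -/
example {L : ℕ} {s R : ℕ → ℕ} {t₀ K : ℕ} {Z : Finset (Pt d)} (ht : t₀ ≤ K)
    (hfirst : ∀ k, k < K - t₀ → ¬ Stops L s R t₀ Z k) (hnow : Stops L s R t₀ Z (K - t₀)) :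
    PendingBefore L s R t₀ Z K ∧ ¬ PendingAt L s R t₀ Z K :=
  ⟨⟨ht, hfirst⟩, fun h => h.2 (K - t₀) le_rfl hnow⟩

end Sanity

end

end Summit.QuantumFields.BalabanUV.T4Continuum.HistoryRealisePrint
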